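import Literature.NumberTheory.Automorphic.SatakeParametersGLIsoProofs
import Literature.NumberTheory.Automorphic.HeckeAlgebraFixedPointsProofs
import HarnessLib

/-!
# Hecke eigenvalues of a spherical vector through the Satake transform (`GL_n`)

Topic `NumberTheory/Automorphic`; theorems only (no named fact).  Setting: a non-archimedean
local field `F`, `G = GL_n(F)`, `K = GL_n(𝒪) = glInt n F`, `q = #𝓀`, `ϖ` a uniformizing element,
the spherical Hecke algebra `ℋ(G, K) = End_G(ℂ[G ⧸ K])` (`heckeAlgebra`) with its double-coset
operators `T_g` (`heckeAlgebra.doubleCosetOperator`), the concrete Hecke operators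
`[KgK] = ∑_{yK ⊆ KgK} ρ(y)` (`heckeOperator ρ K g`) on the `K`-fixed vectors of a representation
`ρ`, and the Satake transform `𝒮 : ℋ(G, K) →ₐ[ℂ] ℂ[ℤⁿ]` of `SatakeTransformGL`
(`𝒮(T_g) = ∑_{γ ∈ KgK/K} q^{-⟨ν, e(γ)⟩} x^{e(γ)}`, `e(γ)` the Iwasawa exponent, `ν = (n-1, …, 0)`).

* `laurentEvalAt z : ℂ[ℤⁿ] →ₐ[ℂ] ℂ`, evaluation at `z ∈ (ℂˣ)ⁿ`, and
  `laurentEvalAt_toLaurent`: on polynomials it is `MvPolynomial.eval`.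
* `heckeOperator_apply_eq_laurentEvalAt_satakeTransform_smul` (**eigenvalues through `𝒮`**):
  let `v ∈ V^K` be a common eigenvector of `T_1, …, T_n` with
  `T_r v = q^{-r(r-1)/2} e_r(z) v` for a point `z ∈ (ℂˣ)ⁿ`.  Then for every *integral* `g`
  `[KgK] v = 𝒮(T_g)(z) · v`.
  Proof: `T_g = θ₀(p)` for a polynomial `p` (`SatakeGL.satakeInvPoly`, the inverse Satake map of
  `SatakeParametersGLIsoProofs`, `y_i ↦ q^{i(i+1)/2} T_{i+1}`); the right `ℋ(G, K)`-module
  structure of `V^K` (`heckeAlgebra.fixedPointsAlgHom`, Frobenius reciprocity) turns `θ₀` into an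
  algebra map `ℂ[y] → End(V^K)` under which `y_i` acts on `v` by `e_{i+1}(z)`, so `p` acts by
  `p(e_1(z), …, e_n(z))` (`aeval_apply_eq_eval_smul`); and `𝒮(θ₀ p)(z) = p(e_1(z), …, e_n(z))`
  because `𝒮 ∘ θ₀ = (y_i ↦ e_{i+1}(x))` (`SatakeGL.satakeTransform_comp_satakeInvPoly`).  This is
  the statement "the spherical function with parameter `z` is `ω_z(T_g) = 𝒮(T_g)(z)`"
  (Cartier, Corvallis 1979, §IV.3–IV.4, Thm. 4.2's setting; Macdonald (1995), Ch. V (3.2)–(3.4);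
  Shimura (1971), Thm. 3.21), obtained here without multiplicity one and without a model of `ρ`.
* `IsSatakeParameter`-form (`exists_units_heckeOperator_apply_eq_of_heckeT`): the eigenvalue
  equations `T_i v = q^{i(n-i)/2} e_i(α) v` of `IsSatakeParameter ρ ϖ α` are those of the point
  `z = q^{(n-1)/2} α` (any ordering of `α`; `α_j ≠ 0`).
* **Bounds** (`norm_laurentEvalAt_satakeTransform_le`): if `‖z_i‖ = R` for all `i` and
  `g ∈ Δ_m` (integral, `|det g| = |ϖ|^m`) then `‖𝒮(T_g)(z)‖ ≤ R^m · Ξ(g)` with the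
  **orbit sum** `Ξ(g) = orbitTwistSum hϖ g = ∑_{γ ∈ KgK/K} q^{-⟨ν, e(γ)⟩} ≥ 0` (the value at `g` of
  `#(KgK/K)` times Harish-Chandra's spherical function `Ξ`, up to the power of `q^{(n-1)/2}`
  carried by `|det|`); together with `card_orbit_mul_apply_eq_apply_heckeOperator`
  (`#(KgK/K) · φ(ρ(g) v) = φ([KgK] v)` for `K`-invariant `φ` and `v`) this bounds the zonal
  spherical function: `#(KgK/K) ‖φ(ρ(g) v)‖ ≤ ‖φ v‖ R^m Ξ(g)`
  (`card_orbit_mul_norm_apply_le`).  The estimate of `Ξ(g)` itself (Harish-Chandra / Macdonald) is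
  not in this file.

## References

* P. Cartier, *Representations of 𝔭-adic groups: a survey*, Proc. Sympos. Pure Math. 33 (1979),
  part 1, §IV [CartierCorvallis1979].
* I. G. Macdonald, *Symmetric functions and Hall polynomials*, 2nd ed. (1995), Ch. V, §3,
  (3.2)–(3.3) (book pp. 298–299; PDF pp. 248–249 of the held copy
  `book:macdonald1995-symmetric-functions-hall-polynomials`) [Macdonald1995].
* G. Shimura, *Introduction to the arithmetic theory of automorphic functions* (1971), Thm. 3.21
  [ShimuraIATAF1971].
-/

noncomputable section

open scoped Pointwise MatrixGroups
open MulAction ValuativeRel Matrix Finset MonoidAlgebra Representation MvPolynomial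

universe u

namespace Literature.NumberTheory.Automorphic

/-! ### Evaluation of Laurent polynomials -/

section Eval

variable {n : ℕ}

/-- The monomial character `m ↦ ∏ i, z_i ^ {m_i}` of `ℤⁿ` attached to `z ∈ (ℂˣ)ⁿ`. [folklore] -/
def laurentMonomialHom (z : Fin n → ℂˣ) : Multiplicative (Fin n → ℤ) →* ℂ where
  toFun m := ((∏ i, z i ^ (Multiplicative.toAdd m i) : ℂˣ) : ℂ)
  map_one' := by simp
  map_mul' a b := by
    change (((∏ i, z i ^ ((Multiplicative.toAdd a + Multiplicative.toAdd b) i) : ℂˣ) : ℂ)) =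
      ((∏ i, z i ^ (Multiplicative.toAdd a i) : ℂˣ) : ℂ) *
        ((∏ i, z i ^ (Multiplicative.toAdd b i) : ℂˣ) : ℂ)
    rw [← Units.val_mul, ← Finset.prod_mul_distrib]
    congr 1
    exact Finset.prod_congr rfl fun i _ => by rw [Pi.add_apply, _root_.zpow_add]

/-- **Evaluation at `z ∈ (ℂˣ)ⁿ`**: the `ℂ`-algebra map `ℂ[ℤⁿ] → ℂ`, `x^m ↦ ∏ i, z_i^{m_i}`.
[folklore] -/
def laurentEvalAt (z : Fin n → ℂˣ) : AddMonoidAlgebra ℂ (Fin n → ℤ) →ₐ[ℂ] ℂ :=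
  AddMonoidAlgebra.lift ℂ ℂ (Fin n → ℤ) (laurentMonomialHom z)

/-- `laurentEvalAt z (c x^m) = c ∏ i, z_i ^ m_i`. [folklore] -/
theorem laurentEvalAt_single (z : Fin n → ℂˣ) (m : Fin n → ℤ) (c : ℂ) :
    laurentEvalAt z (AddMonoidAlgebra.single m c) = c * ∏ i, ((z i : ℂ) ^ m i) := by
  rw [laurentEvalAt, AddMonoidAlgebra.lift_single, smul_eq_mul]
  congr 1
  change (((∏ i, z i ^ m i : ℂˣ) : ℂ)) = _
  rw [Units.coe_prod]
  exact Finset.prod_congr rfl fun i _ => Units.val_zpow_eq_zpow_val _ _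

/-- On polynomials `laurentEvalAt z ∘ toLaurent` is evaluation at `z`. [folklore] -/
theorem laurentEvalAt_comp_toLaurent (z : Fin n → ℂˣ) :
    (laurentEvalAt z).comp (SymmLaurent.toLaurent n) = MvPolynomial.aeval fun i => (z i : ℂ) := by
  refine MvPolynomial.algHom_ext fun i => ?_
  rw [AlgHom.comp_apply, aeval_X, show (X i : MvPolynomial (Fin n) ℂ) =
      monomial (Finsupp.single i 1) 1 from rfl, SymmLaurent.toLaurent_monomial,
    laurentEvalAt_single, one_mul, Finset.prod_eq_single i]
  · rw [SymmLaurent.expCast_apply, Finsupp.single_eq_same, Nat.cast_one, zpow_one]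
  · intro j _ hj
    rw [SymmLaurent.expCast_apply, Finsupp.single_eq_of_ne hj, Nat.cast_zero, zpow_zero]
  · intro h
    exact absurd (Finset.mem_univ i) h

/-- `laurentEvalAt z (toLaurent p) = p(z)`. [folklore] -/
theorem laurentEvalAt_toLaurent (z : Fin n → ℂˣ) (p : MvPolynomial (Fin n) ℂ) :
    laurentEvalAt z (SymmLaurent.toLaurent n p) = MvPolynomial.eval (fun i => (z i : ℂ)) p := by
  have h := AlgHom.congr_fun (laurentEvalAt_comp_toLaurent z) p
  rw [AlgHom.comp_apply] at h
  exact h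

/-- `∏ a ^ f i = a ^ ∑ f i` for integer exponents and `a ≠ 0`. [folklore] -/
theorem prod_zpow_eq_zpow_sum {K ι : Type*} [Field K] {a : K} (ha : a ≠ 0)
    (s : Finset ι) (f : ι → ℤ) : ∏ i ∈ s, a ^ f i = a ^ (∑ i ∈ s, f i) := by
  classical
  induction s using Finset.induction_on with
  | empty => rw [Finset.prod_empty, Finset.sum_empty, zpow_zero]
  | insert i s hi ih => rw [Finset.prod_insert hi, Finset.sum_insert hi, ih, zpow_add₀ ha]

/-- The norm of a monomial value: if `‖z_i‖ = R` for all `i` then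
`‖∏ i, z_i ^ m_i‖ = R ^ (∑ i, m_i)`. [folklore] -/
theorem norm_prod_zpow_eq {z : Fin n → ℂˣ} {R : ℝ} (hR : 0 < R) (hz : ∀ i, ‖(z i : ℂ)‖ = R)
    (m : Fin n → ℤ) : ‖∏ i, ((z i : ℂ) ^ m i)‖ = R ^ (∑ i, m i) := by
  rw [norm_prod, ← prod_zpow_eq_zpow_sum hR.ne']
  refine Finset.prod_congr rfl fun i _ => ?_
  rw [norm_zpow, hz i]

end Eval

/-! ### Polynomials in commuting operators on a common eigenvector -/

section Aeval

/-- If `y_i` acts on `v` by the scalar `c_i` under an algebra map `Φ : ℂ[y] → End(M)`, then `p`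
acts on `v` by `p(c)`. [folklore] -/
theorem aeval_apply_eq_eval_smul {σ R M : Type*} [CommSemiring R] [AddCommMonoid M] [Module R M]
    (Φ : MvPolynomial σ R →ₐ[R] Module.End R M) {v : M} {c : σ → R}
    (h : ∀ i, Φ (X i) v = c i • v) (p : MvPolynomial σ R) :
    Φ p v = MvPolynomial.eval c p • v := by
  induction p using MvPolynomial.induction_on with
  | C a => rw [MvPolynomial.algHom_C, Module.algebraMap_end_apply, eval_C]
  | add p q hp hq => rw [map_add, LinearMap.add_apply, hp, hq, map_add, add_smul]
  | mul_X p i hp =>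
    rw [map_mul, Module.End.mul_apply, h i, map_smul, hp, map_mul, eval_X, smul_smul, mul_comm]

end Aeval

/-! ### Eigenvalues through the Satake transform -/

section Eigenvalue

variable {n : ℕ} {F : Type u} [Field F] [ValuativeRel F] [TopologicalSpace F]
  [IsNonarchimedeanLocalField F]
variable {V : Type*} [AddCommGroup V] [Module ℂ V] (ρ : Representation ℂ (GL (Fin n) F) V)

/-- Every `T_g` with `g` integral is `θ₀(p)` for a polynomial `p` in the normalised generators
`q^{r(r-1)/2} T_r` (Cartan decomposition and the dimension count of
`SatakeGL.map_satakeInvPoly_polyGrade_eq`; Tamagawa, Shimura (1971), Thm. 3.20). [folklore] -/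
theorem exists_satakeInvPoly_eq_doubleCosetOperator {ϖ : F} (hϖ : IsUniformizingElement ϖ)
    {g : GL (Fin n) F} (hg : IsIntegralMatrix (g : Matrix (Fin n) (Fin n) F)) :
    ∃ p : MvPolynomial (Fin n) ℂ,
      SatakeGL.satakeInvPoly n hϖ p = heckeAlgebra.doubleCosetOperator (glInt n F) g := by
  obtain ⟨k₁, hk₁, k₂, hk₂, a, -, h⟩ := exists_glInt_mul_mul_eq_piPowGL hϖ hg
  rw [← heckeAlgebra.doubleCosetOperator_mul_mul_eq (glInt n F) hk₁ hk₂, h]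
  have hmem : heckeAlgebra.toVector (glInt n F)
      (heckeAlgebra.doubleCosetOperator (k := ℂ) (glInt n F) (piPowGL hϖ.ne_zero a)) ∈
      Submodule.map (heckeAlgebra.toVector (k := ℂ) (glInt n F) ∘ₗ
        (SatakeGL.satakeInvPoly n hϖ).toLinearMap) (SatakeGL.polyGrade n (∑ i, a i)) := by
    rw [SatakeGL.map_satakeInvPoly_polyGrade_eq]
    exact Submodule.mem_map_of_mem
      (SatakeGL.doubleCosetOperator_mem_heckeGrade (piPowGL_mem_glIntDet hϖ a))
  obtain ⟨p, -, hp⟩ := Submodule.mem_map.1 hmem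
  exact ⟨p, heckeAlgebra.toVector_injective (glInt n F) hp⟩

open scoped IsMulCommutative in
/-- The algebra map `ℂ[y_1, …, y_n] → End(V^K)`, `p ↦ (v ↦ v · θ₀(p))`: the inverse Satake map
`θ₀` (`SatakeGL.satakeInvPoly`) followed by the right action of the commutative algebra
`ℋ(G, K)` on `V^K` (`heckeAlgebra.fixedPointsAlgHom`). [folklore] -/
def satakePolyAction {ϖ : F} (hϖ : IsUniformizingElement ϖ) :
    MvPolynomial (Fin n) ℂ →ₐ[ℂ] Module.End ℂ (ρ.fixedPoints (glInt n F)) :=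
  (heckeAlgebra.fixedPointsAlgHom (glInt n F) ρ).comp
    ((SatakeGL.satakeInvPoly n hϖ).toOpposite fun _ _ => Commute.all _ _)

/-- `satakePolyAction` of `p` acts by the Hecke-algebra element `θ₀(p)`:
`(v · θ₀(p)) = Φ(θ₀(p) [K]) v`. [folklore] -/
theorem coe_satakePolyAction_apply {ϖ : F} (hϖ : IsUniformizingElement ϖ)
    (p : MvPolynomial (Fin n) ℂ) (v : ρ.fixedPoints (glInt n F)) :
    (satakePolyAction ρ hϖ p v : V) =
      heckeAlgebra.liftRep (glInt n F) ρ ((SatakeGL.satakeInvPoly n hϖ p :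
        Module.End ℂ (MonoidAlgebra ℂ (GL (Fin n) F ⧸ glInt n F)))
          (MonoidAlgebra.single ((1 : GL (Fin n) F) : GL (Fin n) F ⧸ glInt n F) 1)) v := by
  rw [satakePolyAction, AlgHom.comp_apply, AlgHom.toOpposite_apply, Function.comp_apply,
    heckeAlgebra.coe_fixedPointsAlgHom_apply]

/-- A double-coset operator acts through `fixedPointsAlgHom` by the concrete Hecke operator:
`Φ(T_g [K]) v = [KgK] v`. [folklore] -/
theorem liftRep_doubleCosetOperator_apply (g : GL (Fin n) F) (v : V) :
    heckeAlgebra.liftRep (glInt n F) ρ ((heckeAlgebra.doubleCosetOperator (k := ℂ) (glInt n F) g :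
        Module.End ℂ (MonoidAlgebra ℂ (GL (Fin n) F ⧸ glInt n F)))
          (MonoidAlgebra.single ((1 : GL (Fin n) F) : GL (Fin n) F ⧸ glInt n F) 1)) v =
      heckeOperator ρ (glInt n F) g v := by
  have h := heckeAlgebra.toVector_doubleCosetOperator (k := ℂ) (glInt n F) g
  rw [heckeAlgebra.toVector_apply] at h
  rw [h, heckeAlgebra.liftRep_doubleCosetIndicator]

/-- **Hecke eigenvalues through the Satake transform.** Let `v ∈ V^K` satisfy
`T_r v = q^{-r(r-1)/2} e_r(z) v` for `1 ≤ r ≤ n` and a point `z ∈ (ℂˣ)ⁿ` (equivalently: the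
normalised generators `q^{r(r-1)/2} T_r` act by `e_r(z)`).  Then for every integral `g`,
`[KgK] v = 𝒮(T_g)(z) v`: the spherical vector is an eigenvector of the whole Hecke algebra, with
eigencharacter `T ↦ 𝒮(T)(z)` — Macdonald (1995), Ch. V, (3.2)–(3.3) and proof of (3.3):
"`ω̂_s` is the composition of `θ` with the specialization `x_i ↦ z_i = q^{(n-1)/2 - s_i}`"
(book p. 299; PDF p. 248 of the held copy); Cartier, Corvallis 1979, §IV.3–4; Shimura (1971),
Thm. 3.21. [cite: Macdonald1995, Ch. V (3.2)–(3.3)] -/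
theorem heckeOperator_apply_eq_laurentEvalAt_satakeTransform_smul
    {ϖ : F} (hϖ : IsUniformizingElement ϖ) {v : V} (hv : v ∈ ρ.fixedPoints (glInt n F))
    (z : Fin n → ℂˣ)
    (hT : ∀ r, 1 ≤ r → r ≤ n →
      heckeOperator ρ (glInt n F) (heckeDiag n (Units.mk0 ϖ hϖ.ne_zero) r) v =
        ((((Nat.card 𝓀[F] : ℂ) ^ (r * (r - 1) / 2))⁻¹ *
          MvPolynomial.eval (fun i => (z i : ℂ)) (MvPolynomial.esymm (Fin n) ℂ r)) • v))
    {g : GL (Fin n) F} (hg : IsIntegralMatrix (g : Matrix (Fin n) (Fin n) F)) :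
    heckeOperator ρ (glInt n F) g v =
      laurentEvalAt z (satakeTransform hϖ (heckeAlgebra.doubleCosetOperator (glInt n F) g)) • v := by
  obtain ⟨p, hp⟩ := exists_satakeInvPoly_eq_doubleCosetOperator hϖ hg
  have hq0 : ((Nat.card 𝓀[F] : ℕ) : ℂ) ≠ 0 := natCard_residueField_ne_zero
  -- the generators act on `v` by `e_{i+1}(z)`
  have hX : ∀ i : Fin n, satakePolyAction ρ hϖ (X i) ⟨v, hv⟩ =
      MvPolynomial.eval (fun j => (z j : ℂ)) (MvPolynomial.esymm (Fin n) ℂ ((i : ℕ) + 1)) •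
        (⟨v, hv⟩ : ρ.fixedPoints (glInt n F)) := by
    intro i
    apply Subtype.ext
    rw [coe_satakePolyAction_apply, SatakeGL.satakeInvPoly_X, SatakeGL.satakeInvGen,
      Subalgebra.coe_smul, LinearMap.smul_apply, map_smul, LinearMap.smul_apply,
      liftRep_doubleCosetOperator_apply, hT ((i : ℕ) + 1) (by omega) (by omega), smul_smul,
      Nat.add_sub_cancel, mul_inv_cancel_left₀ (pow_ne_zero _ hq0)]
    rfl
  -- hence `p` acts by `p(e(z))`
  have hact := aeval_apply_eq_eval_smul (satakePolyAction ρ hϖ) (v := (⟨v, hv⟩ : ρ.fixedPoints _))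
    (c := fun i : Fin n => MvPolynomial.eval (fun j => (z j : ℂ))
      (MvPolynomial.esymm (Fin n) ℂ ((i : ℕ) + 1))) hX p
  have hact' := congrArg Subtype.val hact
  rw [coe_satakePolyAction_apply, hp, liftRep_doubleCosetOperator_apply] at hact'
  rw [hact', SetLike.val_smul]
  congr 1
  -- and `𝒮(θ₀ p)(z) = p(e(z))`: both sides are algebra maps `ℂ[y] → ℂ` agreeing on the `y_i`
  rw [← hp]
  have key : (laurentEvalAt z).comp ((satakeTransform hϖ).comp (SatakeGL.satakeInvPoly n hϖ)) =
      MvPolynomial.aeval fun i : Fin n => MvPolynomial.eval (fun j => (z j : ℂ))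
        (MvPolynomial.esymm (Fin n) ℂ ((i : ℕ) + 1)) := by
    refine MvPolynomial.algHom_ext fun i => ?_
    have hi := i.is_lt
    rw [AlgHom.comp_apply, AlgHom.comp_apply, SatakeGL.satakeInvPoly_X,
      SatakeGL.satakeTransform_satakeInvGen hϖ (by omega), laurentEvalAt_toLaurent, aeval_X]
  have hkey := AlgHom.congr_fun key p
  rw [AlgHom.comp_apply, AlgHom.comp_apply] at hkey
  exact hkey.symm

/-! ### The point `z = q^{(n-1)/2} α` of a multiset of Satake parameters -/

/-- Scaling a multiset scales its elementary symmetric functions: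
`e_r(c α) = c^r e_r(α)`. [folklore] -/
theorem multiset_esymm_map_mul {R : Type*} [CommRing R] (s : Multiset R) (c : R) (r : ℕ) :
    (s.map fun a => c * a).esymm r = c ^ r * s.esymm r := by
  rw [Multiset.esymm, Multiset.esymm, Multiset.powersetCard_map, Multiset.map_map,
    ← Multiset.sum_map_mul_left]
  refine congrArg Multiset.sum (Multiset.map_congr rfl fun t ht => ?_)
  rw [Multiset.mem_powersetCard] at ht
  rw [Function.comp_apply, Multiset.prod_map_mul, Multiset.map_const', Multiset.prod_replicate, ht.2,
    Multiset.map_id']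

/-- `(√q)^{r(r-1)} = q^{r(r-1)/2}` (the exponent is even). [folklore] -/
theorem sqrt_pow_mul_pred_eq (q r : ℕ) :
    ((Real.sqrt q : ℝ) : ℂ) ^ (r * (r - 1)) = ((q : ℂ) ^ (r * (r - 1) / 2)) := by
  have h2 : r * (r - 1) = 2 * (r * (r - 1) / 2) :=
    (Nat.mul_div_cancel' (even_iff_two_dvd.mp (Nat.even_mul_pred_self r))).symm
  conv_lhs => rw [h2]
  rw [pow_mul, ← Complex.ofReal_pow, Real.sq_sqrt (Nat.cast_nonneg _), Complex.ofReal_natCast]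

/-- **The Satake point of `IsSatakeParameter`.** If `v` satisfies the eigenvalue equations
`T_i v = q^{i(n-i)/2} e_i(α) v` (`i ≤ n`) of `IsSatakeParameter ρ ϖ α` for a multiset `α` of
`n` non-zero complex numbers, then, for any enumeration of `α`, the point
`z = q^{(n-1)/2} α ∈ (ℂˣ)ⁿ` satisfies the hypothesis of
`heckeOperator_apply_eq_laurentEvalAt_satakeTransform_smul`:
`T_r v = q^{-r(r-1)/2} e_r(z) v` (as `q^{-r(r-1)/2} q^{r(n-1)/2} = q^{r(n-r)/2}`). [folklore] -/
theorem exists_units_heckeOperator_apply_eq_of_heckeT {ϖ : Fˣ} (hϖ : IsUniformizingElement (ϖ : F))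
    {α : Multiset ℂ} (hcard : Multiset.card α = n) (h0 : ∀ a ∈ α, a ≠ 0) {v : V}
    (hT : ∀ i ≤ n, heckeT ρ ϖ i v =
      (((Real.sqrt (Nat.card 𝓀[F]) ^ (i * (n - i)) : ℝ) : ℂ) * α.esymm i) • v) :
    ∃ z : Fin n → ℂˣ,
      (Finset.univ.val.map fun i => (z i : ℂ)) =
          α.map (fun a => ((Real.sqrt (Nat.card 𝓀[F]) : ℝ) : ℂ) ^ (n - 1) * a) ∧
        ∀ r, 1 ≤ r → r ≤ n →
          heckeOperator ρ (glInt n F) (heckeDiag n (Units.mk0 (ϖ : F) hϖ.ne_zero) r) v =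
            ((((Nat.card 𝓀[F] : ℂ) ^ (r * (r - 1) / 2))⁻¹ *
              MvPolynomial.eval (fun i => (z i : ℂ)) (MvPolynomial.esymm (Fin n) ℂ r)) • v) := by
  classical
  set c : ℂ := ((Real.sqrt (Nat.card 𝓀[F]) : ℝ) : ℂ) ^ (n - 1) with hc
  have hq0 : ((Nat.card 𝓀[F] : ℕ) : ℂ) ≠ 0 := natCard_residueField_ne_zero
  have hsq0 : ((Real.sqrt (Nat.card 𝓀[F]) : ℝ) : ℂ) ≠ 0 := by
    rw [Ne, Complex.ofReal_eq_zero, Real.sqrt_eq_zero (Nat.cast_nonneg _)]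
    exact_mod_cast Nat.card_pos.ne'
  have hc0 : c ≠ 0 := pow_ne_zero _ hsq0
  -- enumerate `α`
  set l : List ℂ := α.toList with hl
  have hlen : l.length = n := by rw [hl, Multiset.length_toList, hcard]
  have hlα : (l : Multiset ℂ) = α := Multiset.coe_toList α
  have hget0 : ∀ i : Fin n, l.get (Fin.cast hlen.symm i) ≠ 0 := fun i =>
    h0 _ (by rw [← hlα]; exact List.get_mem _ _)
  set z : Fin n → ℂˣ := fun i => Units.mk0 (c * l.get (Fin.cast hlen.symm i))
    (mul_ne_zero hc0 (hget0 i)) with hz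
  -- the underlying multiset of `z` is `c • α`
  have hmap : (Finset.univ.val.map fun i : Fin n => l.get (Fin.cast hlen.symm i)) = α := by
    rw [← hlα]
    subst hlen
    rw [Fin.univ_val_map]
    exact congrArg ((↑) : List ℂ → Multiset ℂ) (List.ofFn_get l)
  have hzα : (Finset.univ.val.map fun i => (z i : ℂ)) = α.map fun a => c * a := by
    conv_rhs => rw [← hmap, Multiset.map_map]
    rfl
  refine ⟨z, hzα, fun r h1r hrn => ?_⟩
  have heval : MvPolynomial.eval (fun i => (z i : ℂ)) (MvPolynomial.esymm (Fin n) ℂ r) =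
      c ^ r * α.esymm r := by
    have h := MvPolynomial.aeval_esymm_eq_multiset_esymm (Fin n) ℂ r (fun i => (z i : ℂ))
    rw [hzα, multiset_esymm_map_mul] at h
    exact h
  rw [heval, Units.mk0_val, ← heckeT_def, hT r hrn]
  congr 1
  -- `(√q)^{r(n-r)} = q^{-r(r-1)/2} ((√q)^{n-1})^r`
  rw [hc, ← pow_mul, ← mul_assoc, Complex.ofReal_pow]
  congr 1
  rw [eq_inv_mul_iff_mul_eq₀ (pow_ne_zero _ hq0), ← sqrt_pow_mul_pred_eq, ← pow_add]
  congr 1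
  rcases Nat.eq_zero_or_pos r with rfl | hr
  · simp
  · have h1 : r - 1 + (n - r) = n - 1 := by omega
    rw [← mul_add, h1, mul_comm]

/-- The norms of the coordinates of the Satake point: if `‖a‖ = 1` for all `a ∈ α` then
`‖z_i‖ = (√q)^{n-1}` for the point `z` of `exists_units_heckeOperator_apply_eq_of_heckeT`.
[folklore] -/
theorem norm_eq_of_univ_val_map_eq {α : Multiset ℂ} {c : ℂ} {z : Fin n → ℂˣ}
    (hz : (Finset.univ.val.map fun i => (z i : ℂ)) = α.map (fun a => c * a))
    (h1 : ∀ a ∈ α, ‖a‖ = 1) (i : Fin n) : ‖(z i : ℂ)‖ = ‖c‖ := by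
  have hi : (z i : ℂ) ∈ Finset.univ.val.map fun i => (z i : ℂ) :=
    Multiset.mem_map_of_mem _ (Finset.mem_univ_val i)
  rw [hz, Multiset.mem_map] at hi
  obtain ⟨a, ha, h⟩ := hi
  rw [← h, norm_mul, h1 a ha, mul_one]

/-! ### The orbit sum `Ξ(g) = ∑_{γ ∈ KgK/K} q^{-⟨ν, e(γ)⟩}` and the bound on `𝒮(T_g)(z)` -/

/-- **The orbit sum** `Ξ(g) = ∑_{γ ∈ KgK/K} q^{-⟨ν, e(γ)⟩}`: the Satake transform `𝒮(T_g)`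
evaluated at the trivial parameter `x = 1`, i.e. `#(KgK/K)` times the value at `g` of
Harish-Chandra's spherical function `Ξ` of `GL_n(F)` (in the normalisation of `satakeWeight`,
which differs from `δ^{1/2}` by `|det|^{(n-1)/2}`). [folklore] -/
def orbitTwistSum {ϖ : F} (hϖ : IsUniformizingElement ϖ) (g : GL (Fin n) F) : ℝ :=
  ∑ γ ∈ (finite_orbit_quotient (glInt n F) g).toFinset,
    (Nat.card 𝓀[F] : ℝ) ^ (-satakeTwistExp (iwasawaExp hϖ γ.out))

/-- `Ξ(g) ≥ 0`. [folklore] -/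
theorem orbitTwistSum_nonneg {ϖ : F} (hϖ : IsUniformizingElement ϖ) (g : GL (Fin n) F) :
    0 ≤ orbitTwistSum hϖ g :=
  Finset.sum_nonneg fun _ _ => zpow_nonneg (Nat.cast_nonneg _) _

/-- `Ξ(g)` only depends on `KgK`. [folklore] -/
theorem orbitTwistSum_eq_of_orbit_eq {ϖ : F} (hϖ : IsUniformizingElement ϖ) {g g' : GL (Fin n) F}
    (h : MulAction.orbit (glInt n F) (g : GL (Fin n) F ⧸ glInt n F) =
      MulAction.orbit (glInt n F) (g' : GL (Fin n) F ⧸ glInt n F)) :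
    orbitTwistSum hϖ g = orbitTwistSum hϖ g' := by
  unfold orbitTwistSum
  have : (finite_orbit_quotient (glInt n F) g).toFinset =
      (finite_orbit_quotient (glInt n F) g').toFinset := by
    ext γ; rw [Set.Finite.mem_toFinset, Set.Finite.mem_toFinset, h]
  rw [this]

/-- `Ξ(k₁ g k₂) = Ξ(g)` for `k₁, k₂ ∈ K`. [folklore] -/
theorem orbitTwistSum_mul_mul {ϖ : F} (hϖ : IsUniformizingElement ϖ) {g k₁ k₂ : GL (Fin n) F}
    (hk₁ : k₁ ∈ glInt n F) (hk₂ : k₂ ∈ glInt n F) :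
    orbitTwistSum hϖ (k₁ * g * k₂) = orbitTwistSum hϖ g := by
  refine orbitTwistSum_eq_of_orbit_eq hϖ (MulAction.orbit_eq_iff.2 ?_)
  exact (heckeAlgebra.coe_mem_orbit_coe_iff (glInt n F) g (k₁ * g * k₂)).2 ⟨k₁, hk₁, k₂, hk₂, rfl⟩

/-- **`𝒮(T_g)(z)` as an orbit sum**: `𝒮(T_g)(z) = ∑_{γ ∈ KgK/K} q^{-⟨ν, e(γ)⟩} z^{e(γ)}`.
[folklore] -/
theorem laurentEvalAt_satakeTransform_doubleCosetOperator {ϖ : F} (hϖ : IsUniformizingElement ϖ)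
    (z : Fin n → ℂˣ) (g : GL (Fin n) F) :
    laurentEvalAt z (satakeTransform hϖ (heckeAlgebra.doubleCosetOperator (glInt n F) g)) =
      ∑ γ ∈ (finite_orbit_quotient (glInt n F) g).toFinset,
        (Nat.card 𝓀[F] : ℂ) ^ (-satakeTwistExp (iwasawaExp hϖ γ.out)) *
          ∏ i, (z i : ℂ) ^ (iwasawaExp hϖ γ.out i) := by
  rw [satakeTransform_doubleCosetOperator, map_sum]
  exact Finset.sum_congr rfl fun γ _ => by rw [laurentEvalAt_single]; rfl

omit [ValuativeRel F] [TopologicalSpace F] [IsNonarchimedeanLocalField F] in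
/-- The determinant of an upper unitriangular matrix is `1`. [folklore] -/
theorem det_coe_eq_one_of_mem_upperUnitriangular {u : GL (Fin n) F}
    (hu : u ∈ upperUnitriangular (Fin n) F) : (u : Matrix (Fin n) (Fin n) F).det = 1 := by
  rw [mem_upperUnitriangular_iff] at hu
  rw [Matrix.det_of_upperTriangular hu.1]
  exact Finset.prod_eq_one fun i _ => hu.2 i

/-- **`|det| = |ϖ|^{∑ e_i}`**: the Iwasawa exponent of `g ∈ Δ_m` has total degree `m`.
[folklore] -/
theorem sum_iwasawaExp_eq_of_mem_glIntDet {ϖ : F} (hϖ : IsUniformizingElement ϖ)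
    {g : GL (Fin n) F} {m : ℕ} (hg : g ∈ glIntDet n ϖ m) :
    ∑ i, iwasawaExp hϖ g i = m := by
  obtain ⟨u, hu, k, hk, h⟩ := iwasawaExp_spec hϖ g
  set e := iwasawaExp hϖ g with he
  have hv0 : valuation F ϖ ≠ 0 := (Valuation.ne_zero_iff _).2 hϖ.ne_zero
  -- `|det g| = |ϖ|^{∑ e}`
  have hdet : valuation F (g : Matrix (Fin n) (Fin n) F).det = valuation F ϖ ^ (∑ i, e i) := by
    rw [h, Units.val_mul, Units.val_mul, Matrix.det_mul, Matrix.det_mul, map_mul, map_mul,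
      det_coe_eq_one_of_mem_upperUnitriangular hu, map_one, one_mul,
      valuation_det_eq_one_of_mem_glInt hk, mul_one, coe_zpowDiagGL, Matrix.det_diagonal,
      prod_zpow_eq_zpow_sum hϖ.ne_zero, map_zpow₀]
  rw [hg.2] at hdet
  -- hence `ϖ^{∑ e - m}` and its inverse are integral
  have hint : ∀ d : ℤ, valuation F ϖ ^ d = 1 → ϖ ^ d ∈ 𝒪[F] := fun d hd => by
    rw [Valuation.mem_integer_iff, map_zpow₀, hd]
  have h1 : valuation F ϖ ^ ((∑ i, e i) - (m : ℤ)) = 1 := by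
    rw [zpow_sub₀ hv0, ← hdet, zpow_natCast, div_self (pow_ne_zero _ hv0)]
  have h2 : valuation F ϖ ^ (-((∑ i, e i) - (m : ℤ))) = 1 := by
    rw [_root_.zpow_neg, h1, inv_one]
  have := hϖ.eq_zero_of_zpow_mem (hint _ h1) (hint _ h2)
  omega

/-- **The bound on the eigenvalue.** If `‖z_i‖ = R > 0` for all `i` and `g ∈ Δ_m` (integral,
`|det g| = |ϖ|^m`), then `‖𝒮(T_g)(z)‖ ≤ R^m Ξ(g)`. For a unitary Satake point
`z = q^{(n-1)/2} α`, `|α_j| = 1`, this is `|ω_α(T_g)| ≤ q^{(n-1)m/2} Ξ(g)` — the spherical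
function with unitary parameters is dominated by Harish-Chandra's `Ξ` (the positivity of the
coefficients of `𝒮(T_g)`; cf. Macdonald (1995), Ch. V, §3, Example after (3.5)). [folklore] -/
theorem norm_laurentEvalAt_satakeTransform_le {ϖ : F} (hϖ : IsUniformizingElement ϖ)
    {z : Fin n → ℂˣ} {R : ℝ} (hR : 0 < R) (hz : ∀ i, ‖(z i : ℂ)‖ = R)
    {g : GL (Fin n) F} {m : ℕ} (hg : g ∈ glIntDet n ϖ m) :
    ‖laurentEvalAt z (satakeTransform hϖ (heckeAlgebra.doubleCosetOperator (glInt n F) g))‖ ≤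
      R ^ m * orbitTwistSum hϖ g := by
  rw [laurentEvalAt_satakeTransform_doubleCosetOperator, orbitTwistSum, Finset.mul_sum]
  refine (norm_sum_le _ _).trans (Finset.sum_le_sum fun γ hγ => ?_)
  rw [Set.Finite.mem_toFinset] at hγ
  -- `γ.out ∈ Δ_m`, so `∑ e(γ.out) = m`
  have hγm : γ.out ∈ glIntDet n ϖ m := by
    obtain ⟨κ, rfl⟩ := MulAction.mem_orbit_iff.1 hγ
    rw [smul_out_mem_glIntDet_iff, mk_out_mem_glIntDet_iff]
    exact hg
  rw [norm_mul, norm_prod_zpow_eq hR hz, sum_iwasawaExp_eq_of_mem_glIntDet hϖ hγm, zpow_natCast,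
    mul_comm, Complex.norm_zpow, Complex.norm_natCast]

/-! ### The zonal spherical function: `#(KgK/K) φ(ρ(g) v) = φ([KgK] v)` -/

omit [TopologicalSpace F] [IsNonarchimedeanLocalField F] in
/-- For a `K`-invariant linear form `φ` and a `K`-fixed vector `v`, the coefficient
`g ↦ φ(ρ(g) v)` is bi-`K`-invariant. [folklore] -/
theorem apply_mul_mul_eq_of_invariant {φ : Module.Dual ℂ V}
    (hφ : ∀ k ∈ glInt n F, ∀ w : V, φ (ρ k w) = φ w) {v : V} (hv : v ∈ ρ.fixedPoints (glInt n F))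
    (g : GL (Fin n) F) {k₁ k₂ : GL (Fin n) F} (hk₁ : k₁ ∈ glInt n F) (hk₂ : k₂ ∈ glInt n F) :
    φ (ρ (k₁ * g * k₂) v) = φ (ρ g v) := by
  rw [map_mul, map_mul, Module.End.mul_apply, Module.End.mul_apply,
    (ρ.mem_fixedPoints _ v).1 hv k₂ hk₂, hφ k₁ hk₁]

/-- **`#(KgK/K) · φ(ρ(g) v) = φ([KgK] v)`** for a `K`-invariant `φ` and `v ∈ V^K`: the Hecke
operator of `KgK` acts on the zonal coefficient by the number of left cosets times its
(constant) value on `KgK` (Cartier, Corvallis 1979, §IV.3; Macdonald (1971), §3.3). [folklore] -/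
theorem card_orbit_mul_apply_eq_apply_heckeOperator {φ : Module.Dual ℂ V}
    (hφ : ∀ k ∈ glInt n F, ∀ w : V, φ (ρ k w) = φ w) {v : V} (hv : v ∈ ρ.fixedPoints (glInt n F))
    (g : GL (Fin n) F) :
    ((finite_orbit_quotient (glInt n F) g).toFinset.card : ℂ) * φ (ρ g v) =
      φ (heckeOperator ρ (glInt n F) g v) := by
  rw [heckeOperator, finsum_mem_eq_finite_toFinset_sum _ (finite_orbit_quotient (glInt n F) g),
    LinearMap.sum_apply, map_sum]
  rw [Finset.sum_congr rfl fun γ hγ => show φ (ρ γ.out v) = φ (ρ g v) from ?_, Finset.sum_const,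
    nsmul_eq_mul]
  rw [Set.Finite.mem_toFinset] at hγ
  have hγ' : ((γ.out : GL (Fin n) F) : GL (Fin n) F ⧸ glInt n F) ∈
      MulAction.orbit (glInt n F) (g : GL (Fin n) F ⧸ glInt n F) := by
    rwa [QuotientGroup.out_eq']
  obtain ⟨a, ha, b, hb, hab⟩ := (heckeAlgebra.coe_mem_orbit_coe_iff (glInt n F) g γ.out).1 hγ'
  rw [hab, apply_mul_mul_eq_of_invariant ρ hφ hv g ha hb]

/-- **The zonal spherical function is dominated by `Ξ`.** For a `K`-invariant linear form
`φ`, a `K`-fixed common eigenvector `v` of the `T_r` with unitary-type Satake point `z`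
(`‖z_i‖ = R`), and `g ∈ Δ_m`:
`#(KgK/K) ‖φ(ρ(g) v)‖ ≤ ‖φ v‖ R^m Ξ(g)` (from
`heckeOperator_apply_eq_laurentEvalAt_satakeTransform_smul`, Macdonald (1995), Ch. V (3.2)–(3.3),
and the triangle inequality). [folklore] -/
theorem card_orbit_mul_norm_apply_le {ϖ : F} (hϖ : IsUniformizingElement ϖ)
    {φ : Module.Dual ℂ V} (hφ : ∀ k ∈ glInt n F, ∀ w : V, φ (ρ k w) = φ w)
    {v : V} (hv : v ∈ ρ.fixedPoints (glInt n F)) {z : Fin n → ℂˣ}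
    (hT : ∀ r, 1 ≤ r → r ≤ n →
      heckeOperator ρ (glInt n F) (heckeDiag n (Units.mk0 ϖ hϖ.ne_zero) r) v =
        ((((Nat.card 𝓀[F] : ℂ) ^ (r * (r - 1) / 2))⁻¹ *
          MvPolynomial.eval (fun i => (z i : ℂ)) (MvPolynomial.esymm (Fin n) ℂ r)) • v))
    {R : ℝ} (hR : 0 < R) (hz : ∀ i, ‖(z i : ℂ)‖ = R)
    {g : GL (Fin n) F} {m : ℕ} (hg : g ∈ glIntDet n ϖ m) :
    ((finite_orbit_quotient (glInt n F) g).toFinset.card : ℝ) * ‖φ (ρ g v)‖ ≤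
      ‖φ v‖ * (R ^ m * orbitTwistSum hϖ g) := by
  have h := card_orbit_mul_apply_eq_apply_heckeOperator ρ hφ hv g
  rw [heckeOperator_apply_eq_laurentEvalAt_satakeTransform_smul ρ hϖ hv z hT hg.1, map_smul,
    smul_eq_mul] at h
  have h' := congrArg (‖·‖) h
  rw [norm_mul, Complex.norm_natCast, norm_mul] at h'
  rw [h', mul_comm ‖_‖ ‖φ v‖]
  exact mul_le_mul_of_nonneg_left (norm_laurentEvalAt_satakeTransform_le hϖ hR hz hg) (norm_nonneg _)

end Eigenvalue

end Literature.NumberTheory.Automorphic
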